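import Mathlib

/-!
# Route LiouvilleSarnak — crux `LiouvilleCutRank` (stmt-ValiantsHypothesis-14775), tools:
# THE GRAM / FOURTH-MOMENT COUNT FOR SIGN MATRICES, AND LOGARITHMIC AVERAGES

Route-independent tools (no `Theses` import) for
`Theorems/LiouvilleSarnakLiouvilleCutRankFourPointLogChowla.lean` (four-point logarithmic Chowla
along 4-adic progressions ⇒ `LiouvilleCutRank`).

* §1 ★ `card_sq_le_of_image_card_le` — if a `±1` matrix `B` on `ι × κ` has at most `D` distinct
  rows then
  `(|ι| |κ|)² ≤ D · Σ_{r ≠ r'} Σ_{c ≠ c'} B(r,c) B(r',c) B(r,c') B(r',c') + D · |ι| |κ| (|ι| + |κ|)`.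
  Ingredients: Cauchy–Schwarz on the row fibres (`card_sq_le_card_image_mul_equalPairs`:
  (distinct rows) × #{(r, r') : B r = B r'} ≥ |ι|²); each pair of equal rows contributes `|κ|²` to
  the Gram sum `Σ_{r,r'} ⟨B r, B r'⟩²` (`sq_card_mul_equalPairs_le_gram`); and the Gram sum is the
  four-fold sum over ALL rectangles, whose degenerate rectangles (`r = r'` or `c = c'`) contribute
  `1` each, at most `|ι| |κ| (|ι| + |κ|)` in total (`gram_le_offDiag_add`).  Consequence used
  downstream: with `|ι| = |κ| = N ≥ 3D`, FEW distinct rows force the off-diagonal four-fold sum to be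
  `≥ N³`.
* §2 `not_isLittleO_log_of_one_le` — a real sequence `≥ 1` at every `n ≥ 1` is not `o(log x)` in
  logarithmic average (`Σ_{n ≤ x} 1/n ≥ log (x + 1)`, Mathlib's `log_add_one_le_harmonic`).

Honest framing: elementary counting; nothing here is number theory, and nothing bears on VP versus
VNP.  No definitions.
-/

-- the directory `ValiantsHypothesis/ValiantsHypothesis` repeats the summit name (tree layout)
set_option linter.dupNamespace false

namespace Summit.ValiantsHypothesis.ValiantsHypothesis.Theorems.LiouvilleSarnakLiouvilleCutRank.GramCount

open Finset Filter Asymptotics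

/-! ### §1 The Gram / fourth-moment count for sign matrices -/

/-- For a `±1` matrix, the four-fold product over a degenerate rectangle (`r = r'` or `c = c'`) is
`1`. [folklore] -/
theorem fourfold_eq_one_of_diag {ι κ : Type*} (B : ι → κ → ℤ) (hB : ∀ r c, B r c = 1 ∨ B r c = -1)
    (p : ι × ι) (q : κ × κ) (h : p.1 = p.2 ∨ q.1 = q.2) :
    B p.1 q.1 * B p.2 q.1 * B p.1 q.2 * B p.2 q.2 = 1 := by
  have hsq : ∀ r c, B r c * B r c = 1 := fun r c => by
    rcases hB r c with h1 | h1 <;> rw [h1] <;> norm_num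
  rcases h with h | h
  · rw [← h]
    calc B p.1 q.1 * B p.1 q.1 * B p.1 q.2 * B p.1 q.2
        = (B p.1 q.1 * B p.1 q.1) * (B p.1 q.2 * B p.1 q.2) := by ring
      _ = 1 := by rw [hsq, hsq, mul_one]
  · rw [← h]
    calc B p.1 q.1 * B p.2 q.1 * B p.1 q.1 * B p.2 q.1
        = (B p.1 q.1 * B p.1 q.1) * (B p.2 q.1 * B p.2 q.1) := by ring
      _ = 1 := by rw [hsq, hsq, mul_one]

/-- The sum over all pairs `(c, c')` of the four-fold products is the square of the inner product of
the two rows. [folklore] -/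
theorem sum_fourfold_eq_sq {ι κ : Type*} [Fintype κ] (B : ι → κ → ℤ) (p : ι × ι) :
    ∑ q ∈ (univ : Finset κ) ×ˢ (univ : Finset κ), B p.1 q.1 * B p.2 q.1 * B p.1 q.2 * B p.2 q.2 =
      (∑ c, B p.1 c * B p.2 c) ^ 2 := by
  rw [sq, sum_mul_sum, sum_product]
  refine sum_congr rfl fun c _ => sum_congr rfl fun c' _ => by ring

/-- Equal `±1` rows have inner product `|κ|`. [folklore] -/
theorem sum_mul_self_row {ι κ : Type*} [Fintype κ] (B : ι → κ → ℤ)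
    (hB : ∀ r c, B r c = 1 ∨ B r c = -1) (r : ι) :
    ∑ c, B r c * B r c = Fintype.card κ := by
  have hsq : ∀ c, B r c * B r c = 1 := fun c => by
    rcases hB r c with h1 | h1 <;> rw [h1] <;> norm_num
  simp [hsq]

/-- **Cauchy–Schwarz on row fibres.**  (Number of distinct rows) × (number of ordered pairs of equal
rows) `≥ |ι|²`. [folklore] -/
theorem card_sq_le_card_image_mul_equalPairs {ι κ : Type*} [Fintype ι] [Fintype κ] [DecidableEq ι]
    [DecidableEq κ] (B : ι → κ → ℤ) :
    (Fintype.card ι) ^ 2 ≤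
      ((univ : Finset ι).image B).card *
        ∑ r : ι, ((univ : Finset ι).filter fun r' => B r' = B r).card := by
  classical
  -- `n v` = size of the fibre of the row pattern `v`
  let n : (κ → ℤ) → ℕ := fun v => ((univ : Finset ι).filter fun r' => B r' = v).card
  have hsum : ∑ r : ι, n (B r) = ∑ v ∈ (univ : Finset ι).image B, n v ^ 2 := by
    rw [sum_comp]
    refine sum_congr rfl fun v _ => ?_
    rw [smul_eq_mul, sq]
  have hcard : ∑ v ∈ (univ : Finset ι).image B, n v = Fintype.card ι := by
    rw [← card_univ, card_eq_sum_card_image B (univ : Finset ι)]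
  have hcs := sq_sum_le_card_mul_sum_sq (s := (univ : Finset ι).image B) (f := n)
  rw [hcard, ← hsum] at hcs
  exact hcs

/-- **Lower bound for the Gram sum.**  `|κ|² · #{(r, r') : B r = B r'} ≤ Σ_{r,r'} ⟨B r, B r'⟩²`
(each pair of equal `±1` rows contributes `|κ|²`, every other pair `≥ 0`). [folklore] -/
theorem sq_card_mul_equalPairs_le_gram {ι κ : Type*} [Fintype ι] [Fintype κ] [DecidableEq ι]
    [DecidableEq κ] (B : ι → κ → ℤ) (hB : ∀ r c, B r c = 1 ∨ B r c = -1) :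
    (Fintype.card κ : ℤ) ^ 2 *
        (∑ r : ι, (((univ : Finset ι).filter fun r' => B r' = B r).card : ℤ)) ≤
      ∑ p ∈ (univ : Finset ι) ×ˢ (univ : Finset ι), (∑ c, B p.1 c * B p.2 c) ^ 2 := by
  classical
  rw [sum_product, mul_sum]
  refine sum_le_sum fun r _ => ?_
  rw [mul_comm, ← nsmul_eq_mul, ← sum_const]
  calc ∑ r' ∈ (univ : Finset ι).filter (fun r' => B r' = B r), (Fintype.card κ : ℤ) ^ 2
      = ∑ r' ∈ (univ : Finset ι).filter (fun r' => B r' = B r), (∑ c, B r c * B r' c) ^ 2 := by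
        refine sum_congr rfl fun r' hr' => ?_
        rw [(mem_filter.mp hr').2, sum_mul_self_row B hB r]
    _ ≤ ∑ r' : ι, (∑ c, B r c * B r' c) ^ 2 :=
        sum_le_sum_of_subset_of_nonneg (filter_subset _ _) fun _ _ _ => sq_nonneg _

/-- **Upper bound for the Gram sum.**  `Σ_{r,r'} ⟨B r, B r'⟩²` exceeds the off-diagonal four-fold sum
`Σ_{r ≠ r'} Σ_{c ≠ c'} B(r,c) B(r',c) B(r,c') B(r',c')` by the number of degenerate rectangles, at most
`|ι| |κ| (|ι| + |κ|)` (each degenerate rectangle contributes exactly `1`). [folklore] -/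
theorem gram_le_offDiag_add {ι κ : Type*} [Fintype ι] [Fintype κ] [DecidableEq ι] [DecidableEq κ]
    (B : ι → κ → ℤ) (hB : ∀ r c, B r c = 1 ∨ B r c = -1) :
    ∑ p ∈ (univ : Finset ι) ×ˢ (univ : Finset ι), (∑ c, B p.1 c * B p.2 c) ^ 2 ≤
      (∑ p ∈ (univ : Finset ι).offDiag, ∑ q ∈ (univ : Finset κ).offDiag,
          B p.1 q.1 * B p.2 q.1 * B p.1 q.2 * B p.2 q.2) +
        Fintype.card ι * Fintype.card κ * (Fintype.card ι + Fintype.card κ) := by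
  classical
  -- inner sums: all pairs `q` = diagonal `q` (each term `1`) + off-diagonal `q`
  have hinner : ∀ p : ι × ι, (∑ c, B p.1 c * B p.2 c) ^ 2 =
      (Fintype.card κ : ℤ) + ∑ q ∈ (univ : Finset κ).offDiag,
        B p.1 q.1 * B p.2 q.1 * B p.1 q.2 * B p.2 q.2 := by
    intro p
    rw [← sum_fourfold_eq_sq, ← diag_union_offDiag, sum_union (disjoint_diag_offDiag _)]
    congr 1
    rw [sum_congr rfl fun q hq => fourfold_eq_one_of_diag B hB p q (Or.inr (mem_diag.mp hq).2),
      sum_const, diag_card, card_univ, nsmul_eq_mul, mul_one]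
  -- diagonal `p`: the square is `|κ|²`
  have hdiag : ∀ p ∈ (univ : Finset ι).diag,
      (∑ c, B p.1 c * B p.2 c) ^ 2 = (Fintype.card κ : ℤ) ^ 2 := by
    intro p hp
    rw [← (mem_diag.mp hp).2, sum_mul_self_row B hB p.1]
  -- off-diagonal `p`: bound the diagonal-`q` part by `|κ|`
  rw [← diag_union_offDiag, sum_union (disjoint_diag_offDiag _), sum_congr rfl hdiag, sum_const,
    diag_card, card_univ, nsmul_eq_mul, sum_congr rfl fun p _ => hinner p, sum_add_distrib,
    sum_const, offDiag_card, card_univ, nsmul_eq_mul]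
  have hsub : ((Fintype.card ι * Fintype.card ι - Fintype.card ι : ℕ) : ℤ) ≤
      (Fintype.card ι : ℤ) * Fintype.card ι := by exact_mod_cast Nat.sub_le _ _
  have hκ : (0 : ℤ) ≤ Fintype.card κ := by positivity
  nlinarith [mul_le_mul_of_nonneg_right hsub hκ]

/-- ★ **Gram count.**  If a `±1` matrix `B` on `ι × κ` has at most `D` distinct rows, then
`(|ι| |κ|)² ≤ D · Σ_{r ≠ r'} Σ_{c ≠ c'} B(r,c) B(r',c) B(r,c') B(r',c') + D · |ι| |κ| (|ι| + |κ|)`: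
combine `card_sq_le_card_image_mul_equalPairs`, `sq_card_mul_equalPairs_le_gram` and
`gram_le_offDiag_add`.  So FEW distinct rows force a LARGE off-diagonal four-fold sum. [folklore] -/
theorem card_sq_le_of_image_card_le {ι κ : Type*} [Fintype ι] [Fintype κ] [DecidableEq ι]
    [DecidableEq κ] (B : ι → κ → ℤ) (hB : ∀ r c, B r c = 1 ∨ B r c = -1) (D : ℕ)
    (hD : ((univ : Finset ι).image B).card ≤ D) :
    ((Fintype.card ι : ℤ) * Fintype.card κ) ^ 2 ≤
      D * (∑ p ∈ (univ : Finset ι).offDiag, ∑ q ∈ (univ : Finset κ).offDiag,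
            B p.1 q.1 * B p.2 q.1 * B p.1 q.2 * B p.2 q.2) +
        D * (Fintype.card ι * Fintype.card κ * (Fintype.card ι + Fintype.card κ)) := by
  classical
  have hE := card_sq_le_card_image_mul_equalPairs (κ := κ) B
  have hE' : ((Fintype.card ι : ℤ)) ^ 2 ≤
      (D : ℤ) * ∑ r : ι, (((univ : Finset ι).filter fun r' => B r' = B r).card : ℤ) := by
    have h' := hE.trans (Nat.mul_le_mul_right _ hD)
    exact_mod_cast h'
  have hG := sq_card_mul_equalPairs_le_gram B hB
  have hU := gram_le_offDiag_add B hB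
  have hD0 : (0 : ℤ) ≤ D := by positivity
  have hK0 : (0 : ℤ) ≤ (Fintype.card κ : ℤ) ^ 2 := by positivity
  calc ((Fintype.card ι : ℤ) * Fintype.card κ) ^ 2
      = (Fintype.card κ : ℤ) ^ 2 * (Fintype.card ι : ℤ) ^ 2 := by ring
    _ ≤ (Fintype.card κ : ℤ) ^ 2 *
          ((D : ℤ) * ∑ r : ι, (((univ : Finset ι).filter fun r' => B r' = B r).card : ℤ)) :=
        mul_le_mul_of_nonneg_left hE' hK0
    _ = (D : ℤ) * ((Fintype.card κ : ℤ) ^ 2 *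
          ∑ r : ι, (((univ : Finset ι).filter fun r' => B r' = B r).card : ℤ)) := by ring
    _ ≤ (D : ℤ) * ∑ p ∈ (univ : Finset ι) ×ˢ (univ : Finset ι), (∑ c, B p.1 c * B p.2 c) ^ 2 :=
        mul_le_mul_of_nonneg_left hG hD0
    _ ≤ (D : ℤ) * ((∑ p ∈ (univ : Finset ι).offDiag, ∑ q ∈ (univ : Finset κ).offDiag,
            B p.1 q.1 * B p.2 q.1 * B p.1 q.2 * B p.2 q.2) +
          Fintype.card ι * Fintype.card κ * (Fintype.card ι + Fintype.card κ)) :=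
        mul_le_mul_of_nonneg_left hU hD0
    _ = _ := by ring

/-! ### §2 Logarithmic averages of sequences bounded below -/

/-- A real sequence which is `≥ 1` at every `n ≥ 1` is not `o(log x)` in logarithmic average:
`Σ_{n ≤ x} a(n)/n ≥ Σ_{n ≤ x} 1/n ≥ log x`. [folklore] -/
theorem not_isLittleO_log_of_one_le {a : ℕ → ℝ} (ha : ∀ n : ℕ, 1 ≤ n → 1 ≤ a n)
    (ho : (fun x : ℕ => ∑ n ∈ Icc 1 x, a n / n) =o[atTop] fun x : ℕ => Real.log x) : False := by
  have hev := (ho.def (by norm_num : (0 : ℝ) < 1 / 2)).and (eventually_ge_atTop 2)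
  obtain ⟨x, hx, hx2⟩ := hev.exists
  have hlogpos : 0 < Real.log x := Real.log_pos (by exact_mod_cast hx2)
  -- lower bound: the harmonic sum
  have hharm : Real.log x ≤ ∑ n ∈ Icc 1 x, a n / n := by
    have h1 : Real.log x ≤ Real.log ↑(x + 1) :=
      Real.log_le_log (by positivity) (by exact_mod_cast Nat.le_succ x)
    have h2 : Real.log ↑(x + 1) ≤ (harmonic x : ℝ) := log_add_one_le_harmonic x
    have h3 : (harmonic x : ℝ) = ∑ n ∈ Icc 1 x, (1 : ℝ) / n := by
      rw [harmonic_eq_sum_Icc]; push_cast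
      refine sum_congr rfl fun n _ => by rw [one_div]
    have h4 : ∑ n ∈ Icc 1 x, (1 : ℝ) / n ≤ ∑ n ∈ Icc 1 x, a n / n := by
      refine sum_le_sum fun n hn => ?_
      have hn1 : 1 ≤ n := (mem_Icc.mp hn).1
      exact div_le_div_of_nonneg_right (ha n hn1) (by positivity)
    linarith
  have hnorm1 : ‖∑ n ∈ Icc 1 x, a n / n‖ = ∑ n ∈ Icc 1 x, a n / n :=
    Real.norm_of_nonneg (hlogpos.le.trans hharm)
  have hnorm2 : ‖Real.log x‖ = Real.log x := Real.norm_of_nonneg hlogpos.le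
  rw [hnorm1, hnorm2] at hx
  linarith

end Summit.ValiantsHypothesis.ValiantsHypothesis.Theorems.LiouvilleSarnakLiouvilleCutRank.GramCount
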